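import Literature.MathematicalPhysics.QuantumFieldTheory.Balaban1983to89.B7Eq44TorusAxialGauge

/-!
# `Balaban1983to89.B7Eq45TorusGaugeOrbit` — T. Bałaban, *Averaging operations for lattice gauge theories*, Commun. Math. Phys. **98** (1985) 17–51
# [Balaban1985Averaging] (45) p. 24 «|V₀(∂p) − 1| = |V(∂p) − 1|», read with [Balaban1987RG1] (1.10)–(1.12) p. 262 «a union of orbits [(U, J)]»: ON THE
# PERIODIC LATTICE OF THE pub-balaban NE9 CHAIN THE `U1`-GAUGE ORBIT OF THE SMALL-BOND BALL IS SANDWICHED BETWEEN THE GAUGE-INVARIANT CLASSES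
# «plaquette variables and closed coordinate lines close to 1» — the ∃-packaging «U = V^{g} with V small-bond» that the chain's gauge-orbit leaves consume,
# its converse, the unitarity of the axial gauge, and the NO-GO showing that the closed-line hypothesis cannot be dropped on a torus

statement-level skeleton of published theorems with citation tags; proofs where landed; nothing here is a claim about the Yang–Mills mass gap

PDF held: `paper:balaban1985-cmp98-averaging` (journal page = PDF page + 16); p. 24 re-read AS AN IMAGE by this seat (2026-08-22,
`run/shared/lean/pub/pub-balaban/b2b-balaban-ref1/pages/1985-cmp98-averaging/1985-cmp98-averaging-p008-x2.png`); `paper:balaban1987-cmp109-rg-i-small-field`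
p. 262 re-read AS AN IMAGE (`b2b-balaban-ref1/pages/1987-cmp109-rg-I-small-field/…-p014-x2.png`); `paper:balaban1985-cmp99-background-propagators` pp. 391, 395 (text layer).

THE PRINT (verbatim).  [B7] p. 24 (45): *«Of course, we have |V₀(∂p) − 1| = |V(∂p) − 1| < α₀, |V̄(∂p′) − 1| = |V̄₀(∂p′) − 1|»* (`V₀ = V^{v₀}` the axial
gauge); p. 24: *«for an arbitrary gauge field configuration U and a gauge transformation u, we have U^u(Γ_{c,x})U^u(c)⁻¹ = u(c₋)U(Γ_{c,x})U(c)⁻¹u⁻¹(c₋);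
thus the matrices U^u(Γ_{c,x})U^u(c)⁻¹ and U(Γ_{c,x})U(c)⁻¹ are unitarily equivalent»*.  [Balaban1987RG1] p. 262: *«A G^c-valued gauge transformation u
acts on pairs (U, J) in the following way (U, J)^u = (U^u, R(u)J) = (u₋Uu₊⁻¹, R(u₋)J), (1.10) … The space U^c_j(X, α₀, α₁, γ₀) is a union of orbits
[(U, J)] determined by configurations U, J satisfying the four conditions written below. (i) … |∂U − 1| < α₀ξ² on X, (1.11) for each cube □ ⊂ X of a
size O(1)LM there exists a G-valued gauge transformation u defined on □ and such, that U^u = exp iξA, |A|, |∇^ξA| < O(1)LMBα₀ on □, (1.12)»*.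
[Balaban1985BackgroundPropagators] (3.5) p. 391 *«U(x′, x) = U(x, x′)⁻¹ = U(x, x′)*»*, (3.28) p. 395 *«U^u(x, x′) = u(x)U(x, x′)u⁻¹(x′)»*.

WHY THIS FILE (cell context).  The sibling (A1) `B7Eq44TorusAxialGauge` proves: all plaquette variables `δ`-close and all closed coordinate lines
`θ`-close to `1` ⇒ the torus axial gauge `g = axialGaugeT P U` makes every bond of `U^g` `(d(N−1)²δ + θ)`-close to `1`.  The chain's gauge-orbit leaves
(`B9Thm311GaugeOrbitClosed`, `Support/NE9CurChart*GaugeOrbit`) are stated for `V^{g′}` with `V` in the small-bond ball and `g′` a unit-bounded (unitary)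
gauge.  This file packages (A1) in exactly that shape — `U = V^{g′}`, `V := U^g` small-bond, `g′ := g⁻¹` — so a host obtains the chart AT `U` by
`obtain ⟨V, g′, …, rfl⟩` (the structural proof terms then agree by proof irrelevance); proves print's (45) (the plaquette deviation, and here also the
closed-line deviation, are gauge INVARIANT along `U1`-valued gauges) and the converse inclusion (the orbit of the `ε`-ball has plaquettes `≤ 4ε`, lines
`≤ P_μ ε`); and proves the NO-GO: the field equal to a fixed `h ∈ U1` on the last `μ₀`-slice of `μ₀`-bonds and `1` elsewhere has ALL plaquette variables
EQUAL to `1`, closed `μ₀`-lines equal to `h`, and lies on no `U1`-orbit of the `ε`-ball once `P_{μ₀}·ε < ‖h − 1‖` — on a torus «small plaquettes ⇒ a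
small-bond gauge» is false without the closed lines.

WHAT IS PROVED (sorry-free; 0 def; no `Prop` placeholder).
* §1 unitary letters ((3.5)): `star_units_inv_of_star_eq_inv`, `star_hol_eq_inv` (holonomies of a unitary field are unitary), **`star_axialGaugeT`**,
  **`star_gaugeU`**, `star_inv_gauge`.
* §2 (45) and its converse: **`norm_plaqHolU_gaugeU_sub_one`** (`‖U^g(∂p) − 1‖ = ‖U(∂p) − 1‖` for `g(x) ∈ U1`), **`norm_lineHolT_gaugeU_sub_one`** (same for
  the closed lines); `norm_plaqHolU_sub_one_le_of_small_bonds` (`≤ 4ε`), `norm_lineHolT_sub_one_le_of_small_bonds` (`≤ P_μ·ε`); hence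
  **`small_plaq_line_of_orbit`**: every `V^{g}` with `V` unit-bounded `ε`-small-bond and `g(x) ∈ U1` has plaquettes `≤ 4ε` and closed lines `≤ P_μ ε`.
* §3 THE PACKAGING ((1.12)'s «there exists a gauge transformation u on □» in the shape the chain consumes): **`exists_small_bond_gauge`** — `∃ V g′`,
  `V(b) ∈ U1`, `‖V(b) − 1‖ ≤ d(N−1)²δ + θ`, `g′(x) ∈ U1`, `U = V^{g′}`; **`exists_small_bond_gauge_unitary`** — the same with `V(b)* = V(b)⁻¹`,
  `g′(x)* = g′(x)⁻¹` for unitary `U`.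
* §4 THE NO-GO: `plaqHolU_slice_eq_one` (all plaquette variables of the slice field are `1`), `hol_slice_seg` ∕ `lineHolT_slice` (its closed `μ₀`-lines
  are `h`), **`not_small_bond_orbit_slice`** (`P_{μ₀}·ε < ‖h − 1‖`, `h ∈ U1` ⇒ no `U1`-gauge `g` has all `‖(U_h)^g(b) − 1‖ ≤ ε`).
MODEL / HONEST SCOPE.  The chain's encodings verbatim; general period vector `P`; [folklore] finite-lattice group bookkeeping; nothing of [B7] Props 1–4,
[B9], [I] asserted.  NOT summit progress (cell pub-balaban: NE9 NOT PRINTED / NOT PROVED; «NE9 ⇐ the named binders»; spine PROVED 0/9; HONEST DEPENDENCY: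
continuum YM on T⁴ ⇐ BetaPertH ∧ nine spine estimates (0/9 proved); BetaPertH ⇐ (D1) ∧ (D4) ∧ CAP+tail; G-an2-4 gates asym, D1 and NE2/3/4).  Unit
`b2b-balaban-t4-ne9-formalise-leaf-03` (NE9 crux-team leaf prover, gen 61), INTENT I-ne9leaf03-g61-1 file (A2); NEW file importing (A1) only; modifies
nothing.  Net new unproved facts: 0.
-/

noncomputable section

namespace Literature.MathematicalPhysics.QuantumFieldTheory.Balaban1983to89.B7Eq45TorusGaugeOrbit

open B4Sect5Torus (TSite)
open B9SectCLatticeCarrier (Bond shift shift_apply_val shift_apply_ne)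
open B7Prop1Explicit (e e_apply hol hol_cons hol_nil stepHol stepHol_true stepHol_false seg disp_seg U1 mem_U1 Letter hol_seg_natCast_succ hol_mem
  norm_inv_sub_one_le norm_units_conj_sub_one_le norm_units_inv_conj_sub_one_le)
open B8Lemma1NonAbelian (zsmul_e_apply seg_walk)
open B9Eq315QTorus (perSite perCfg perCfg_apply)
open B9Eq315QTorusOnto (liftSite perSite_liftSite)
open B9Eq310DeltaPrime (plaqHolU)
open B9Eq328GaugeAction (gaugeU gaugeU_apply gaugeU_apply_dir gaugeU_inv_gaugeU plaqHolU_gaugeU)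
open B7Eq44TorusAxialGauge (axialGaugeT lineHolT lineHolT_apply lineHolT_gaugeU axialGaugeT_mem_U1 gaugeU_mem_U1 norm_gaugeU_axialGaugeT_sub_one_le
  perCfg_liftSite)

variable {d : ℕ} (P : Fin d → ℕ)

/-! ## §1 Unitary letters: the gauge and the gauged field are unitary -/

section Unitary

variable {𝔸 : Type*} [Ring 𝔸] [StarMul 𝔸]

/-- A unitary unit has a unitary inverse: `(u⁻¹)* = u` ((3.5) `U(x′, x) = U(x, x′)⁻¹ = U(x, x′)*`). [cite: Balaban1985BackgroundPropagators, (3.5) p.391] -/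
theorem star_units_inv_of_star_eq_inv {u : 𝔸ˣ} (hu : star (u : 𝔸) = ((u⁻¹ : 𝔸ˣ) : 𝔸)) : star (((u⁻¹ : 𝔸ˣ) : 𝔸)) = (u : 𝔸) := by
  calc star (((u⁻¹ : 𝔸ˣ) : 𝔸)) = star (((u⁻¹ : 𝔸ˣ) : 𝔸)) * (star (u : 𝔸) * u) := by rw [hu, Units.inv_mul, mul_one]
    _ = star ((u : 𝔸) * ((u⁻¹ : 𝔸ˣ) : 𝔸)) * u := by rw [star_mul, mul_assoc]
    _ = u := by rw [Units.mul_inv, star_one, one_mul]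

/-- **Holonomies of a unitary field are unitary**: `V(Γ)* = V(Γ)⁻¹` along every word. [cite: Balaban1985Averaging, (9) p.18; Balaban1985BackgroundPropagators, (3.5) p.391] -/
theorem star_hol_eq_inv {V : B7Prop1Explicit.Site d → Fin d → 𝔸ˣ} (hV : ∀ z κ, star (V z κ : 𝔸) = (((V z κ)⁻¹ : 𝔸ˣ) : 𝔸)) :
    ∀ (z : B7Prop1Explicit.Site d) (w : List (Letter d)), star ((hol V z w : 𝔸ˣ) : 𝔸) = (((hol V z w)⁻¹ : 𝔸ˣ) : 𝔸)
  | z, [] => by simp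
  | z, l :: w => by
    rw [hol_cons, mul_inv_rev, Units.val_mul, Units.val_mul, star_mul, star_hol_eq_inv hV (z + l.vec) w]
    congr 1
    unfold stepHol
    split_ifs
    · exact hV _ _
    · rw [inv_inv]; exact star_units_inv_of_star_eq_inv (hV _ _)

variable [∀ i, NeZero (P i)]

/-- **THE AXIAL GAUGE OF A UNITARY FIELD IS UNITARY**: `v₀(x)* = v₀(x)⁻¹`. [cite: Balaban1985Averaging, p.24; Balaban1985BackgroundPropagators, (3.5) p.391] -/
theorem star_axialGaugeT {U : Bond d P → 𝔸ˣ} (hU : ∀ b, star (U b : 𝔸) = (((U b)⁻¹ : 𝔸ˣ) : 𝔸)) (x : TSite d P) :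
    star ((axialGaugeT P U x : 𝔸ˣ) : 𝔸) = (((axialGaugeT P U x)⁻¹ : 𝔸ˣ) : 𝔸) :=
  star_hol_eq_inv (fun _ _ => hU _) _ _

omit [∀ i, NeZero (P i)] in
/-- **A unitary field gauged by a unitary gauge is unitary**: `(U^g(b))* = U^g(b)⁻¹`. [cite: Balaban1985BackgroundPropagators, (3.28) p.395, (3.5) p.391] -/
theorem star_gaugeU {U : Bond d P → 𝔸ˣ} (hU : ∀ b, star (U b : 𝔸) = (((U b)⁻¹ : 𝔸ˣ) : 𝔸)) {g : TSite d P → 𝔸ˣ}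
    (hg : ∀ x, star (g x : 𝔸) = (((g x)⁻¹ : 𝔸ˣ) : 𝔸)) (b : Bond d P) :
    star ((gaugeU g U b : 𝔸ˣ) : 𝔸) = (((gaugeU g U b)⁻¹ : 𝔸ˣ) : 𝔸) := by
  rw [gaugeU_apply, mul_inv_rev, mul_inv_rev, inv_inv, Units.val_mul, Units.val_mul, Units.val_mul, Units.val_mul, star_mul, star_mul, hU, hg,
    star_units_inv_of_star_eq_inv (hg _)]

omit [∀ i, NeZero (P i)] in
/-- The inverse of a unitary gauge is unitary. [cite: Balaban1985BackgroundPropagators, (3.5) p.391] -/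
theorem star_inv_gauge {g : TSite d P → 𝔸ˣ} (hg : ∀ x, star (g x : 𝔸) = (((g x)⁻¹ : 𝔸ˣ) : 𝔸)) (x : TSite d P) :
    star ((g⁻¹ x : 𝔸ˣ) : 𝔸) = (((g⁻¹ x)⁻¹ : 𝔸ˣ) : 𝔸) := by
  rw [Pi.inv_apply, inv_inv]; exact star_units_inv_of_star_eq_inv (hg x)

end Unitary

/-! ## §2 (45): the plaquette and closed-line deviations are gauge invariant; small bonds ⇒ small plaquettes and lines -/

section Invariance

variable [∀ i, NeZero (P i)] {𝔸 : Type*} [NormedRing 𝔸] [NormOneClass 𝔸]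

omit [∀ i, NeZero (P i)] in
/-- **(45) `|V^g(∂p) − 1| = |V(∂p) − 1|`** for every `U1`-valued gauge `g`: the plaquette variable is conjugated at the corner
(`B9Eq328GaugeAction.plaqHolU_gaugeU`) and `‖uXu⁻¹ − 1‖ ≤ ‖X − 1‖` both ways. [cite: Balaban1985Averaging, (45) p.24] -/
theorem norm_plaqHolU_gaugeU_sub_one {g : TSite d P → 𝔸ˣ} (hg : ∀ x, g x ∈ U1 𝔸) (U : Bond d P → 𝔸ˣ) (p : B9SectCLatticeCarrier.Plaq d P) :
    ‖(plaqHolU (gaugeU g U) p : 𝔸) - 1‖ = ‖(plaqHolU U p : 𝔸) - 1‖ := by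
  refine le_antisymm ?_ ?_
  · rw [plaqHolU_gaugeU, Units.val_mul, Units.val_mul]; exact norm_units_conj_sub_one_le (hg _) _
  · conv_lhs => rw [← gaugeU_inv_gaugeU g U]
    rw [plaqHolU_gaugeU, Units.val_mul, Units.val_mul, Pi.inv_apply, inv_inv]; exact norm_units_inv_conj_sub_one_le (hg _) _

/-- **THE CLOSED-LINE DEVIATION IS GAUGE INVARIANT**: `‖U^g(C_{x,μ}) − 1‖ = ‖U(C_{x,μ}) − 1‖` for `g(x) ∈ U1` (print's «unitarily equivalent» for the
closed contours of the torus). [cite: Balaban1985Averaging, (45) p.24, p.24] -/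
theorem norm_lineHolT_gaugeU_sub_one {g : TSite d P → 𝔸ˣ} (hg : ∀ x, g x ∈ U1 𝔸) (U : Bond d P → 𝔸ˣ) (x : TSite d P) (μ : Fin d) :
    ‖((lineHolT P (gaugeU g U) x μ : 𝔸ˣ) : 𝔸) - 1‖ = ‖((lineHolT P U x μ : 𝔸ˣ) : 𝔸) - 1‖ := by
  refine le_antisymm ?_ ?_
  · rw [lineHolT_gaugeU, Units.val_mul, Units.val_mul]; exact norm_units_conj_sub_one_le (hg _) _
  · conv_lhs => rw [← gaugeU_inv_gaugeU g U]
    rw [lineHolT_gaugeU, Units.val_mul, Units.val_mul, Pi.inv_apply, inv_inv]; exact norm_units_inv_conj_sub_one_le (hg _) _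

omit [∀ i, NeZero (P i)] in
/-- **Small bonds ⇒ small plaquettes**: `‖V(∂p) − 1‖ ≤ 4ε` for a unit-bounded field with `‖V(b) − 1‖ ≤ ε` (four factors, two of them inverses).
[cite: Balaban1985Averaging, (44) p.24; Balaban1985BackgroundPropagators, (3.1) p.390] -/
theorem norm_plaqHolU_sub_one_le_of_small_bonds {V : Bond d P → 𝔸ˣ} (hV : ∀ b, V b ∈ U1 𝔸) {ε : ℝ} (hVε : ∀ b, ‖(V b : 𝔸) - 1‖ ≤ ε)
    (p : B9SectCLatticeCarrier.Plaq d P) : ‖(plaqHolU V p : 𝔸) - 1‖ ≤ 4 * ε := by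
  obtain ⟨x, q⟩ := p
  simp only [plaqHolU, Units.val_mul]
  have n1 : ∀ b, ‖(V b : 𝔸)‖ ≤ 1 := fun b => (mem_U1.mp (hV b)).1
  have i1 : ∀ b, ‖(((V b)⁻¹ : 𝔸ˣ) : 𝔸) - 1‖ ≤ ε := fun b => (norm_inv_sub_one_le (hV b)).trans (hVε b)
  have hab : ‖(V (x, q.1.1) : 𝔸) * V (shift q.1.1 x, q.1.2)‖ ≤ 1 := (norm_mul_le _ _).trans (mul_le_one₀ (n1 _) (norm_nonneg _) (n1 _))
  have habc : ‖(V (x, q.1.1) : 𝔸) * V (shift q.1.1 x, q.1.2) * (((V (shift q.1.2 x, q.1.1))⁻¹ : 𝔸ˣ) : 𝔸)‖ ≤ 1 :=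
    (norm_mul_le _ _).trans (mul_le_one₀ hab (norm_nonneg _) (mem_U1.mp (hV _)).2)
  have s1 := B8Ineq170.norm_mul_sub_one_le_of_norm_le_one (b := (((V (x, q.1.2))⁻¹ : 𝔸ˣ) : 𝔸)) habc
  have s2 := B8Ineq170.norm_mul_sub_one_le_of_norm_le_one (b := (((V (shift q.1.2 x, q.1.1))⁻¹ : 𝔸ˣ) : 𝔸)) hab
  have s3 := B8Ineq170.norm_mul_sub_one_le_of_norm_le_one (b := (V (shift q.1.1 x, q.1.2) : 𝔸)) (n1 (x, q.1.1))
  have e1 := hVε (x, q.1.1); have e2 := hVε (shift q.1.1 x, q.1.2); have e3 := i1 (shift q.1.2 x, q.1.1); have e4 := i1 (x, q.1.2)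
  linarith

/-- **Small bonds ⇒ small closed lines**: `‖V(C_{x,μ}) − 1‖ ≤ P_μ·ε` (`B8Lemma1NonAbelian.seg_walk`). [cite: Balaban1985Averaging, (9) p.18, p.25] -/
theorem norm_lineHolT_sub_one_le_of_small_bonds {V : Bond d P → 𝔸ˣ} (hV : ∀ b, V b ∈ U1 𝔸) {ε : ℝ} (hVε : ∀ b, ‖(V b : 𝔸) - 1‖ ≤ ε)
    (x : TSite d P) (μ : Fin d) : ‖((lineHolT P V x μ : 𝔸ˣ) : 𝔸) - 1‖ ≤ P μ * ε := by
  rw [lineHolT_apply]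
  exact seg_walk (perCfg P V) (fun _ _ => hV _) (liftSite x) μ (P μ) fun j _ => by rw [perCfg_apply]; exact hVε _

/-- **(45) READ AS THE GAUGE-INVARIANT HULL OF THE SMALL-BOND BALL**: every `V^g` with `V` unit-bounded and `ε`-small-bond and `g(x) ∈ U1` has ALL
plaquette variables `4ε`-close and ALL closed coordinate lines `P_μ ε`-close to `1` — the converse of (A1)'s `norm_gaugeU_axialGaugeT_sub_one_le`.
[cite: Balaban1985Averaging, (44)–(45) p.24; Balaban1987RG1, (1.10)–(1.12) p.262] -/
theorem small_plaq_line_of_orbit {V : Bond d P → 𝔸ˣ} (hV : ∀ b, V b ∈ U1 𝔸) {ε : ℝ} (hVε : ∀ b, ‖(V b : 𝔸) - 1‖ ≤ ε) {g : TSite d P → 𝔸ˣ}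
    (hg : ∀ x, g x ∈ U1 𝔸) :
    (∀ p : B9SectCLatticeCarrier.Plaq d P, ‖(plaqHolU (gaugeU g V) p : 𝔸) - 1‖ ≤ 4 * ε) ∧
      ∀ (x : TSite d P) (μ : Fin d), ‖((lineHolT P (gaugeU g V) x μ : 𝔸ˣ) : 𝔸) - 1‖ ≤ P μ * ε :=
  ⟨fun p => (norm_plaqHolU_gaugeU_sub_one P hg V p).le.trans (norm_plaqHolU_sub_one_le_of_small_bonds P hV hVε p),
    fun x μ => (norm_lineHolT_gaugeU_sub_one P hg V x μ).le.trans (norm_lineHolT_sub_one_le_of_small_bonds P hV hVε x μ)⟩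

end Invariance

/-! ## §3 The packaging: `U = V^{g′}` with `V` in the small-bond ball -/

section Packaging

variable [∀ i, NeZero (P i)] {𝔸 : Type*} [NormedRing 𝔸] [NormOneClass 𝔸] {U : Bond d P → 𝔸ˣ} (hU : ∀ b, U b ∈ U1 𝔸) {N : ℕ} (hN : ∀ i, P i ≤ N)
  {δ : ℝ} (hδ0 : 0 ≤ δ) (hδ : ∀ p : B9SectCLatticeCarrier.Plaq d P, ‖(plaqHolU U p : 𝔸) - 1‖ ≤ δ) {θ : ℝ} (hθ0 : 0 ≤ θ)
  (hθ : ∀ (x : TSite d P) (μ : Fin d), ‖((lineHolT P U x μ : 𝔸ˣ) : 𝔸) - 1‖ ≤ θ)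

include hU hN hδ0 hδ hθ0 hθ in
/-- **(1.12) «THERE EXISTS A GAUGE TRANSFORMATION u ON □ SUCH THAT U^u IS SMALL», IN THE SHAPE THE CHAIN CONSUMES**: a unit-bounded torus field with all
plaquette variables `δ`-close and all closed coordinate lines `θ`-close to `1` IS `V^{g′}` for a unit-bounded `V` in the small-bond ball of radius
`d(N − 1)²δ + θ` and a unit-bounded gauge `g′` (`V = U^g`, `g′ = g⁻¹`, `g` the torus axial gauge of (A1)). A host of the chain's gauge-orbit leaves uses it as
`obtain ⟨V, g′, hV, hVε, hg′, rfl⟩`. [cite: Balaban1987RG1, (1.11)–(1.12) p.262; Balaban1985Averaging, pp.24–25] -/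
theorem exists_small_bond_gauge :
    ∃ (V : Bond d P → 𝔸ˣ) (g' : TSite d P → 𝔸ˣ), (∀ b, V b ∈ U1 𝔸) ∧ (∀ b, ‖(V b : 𝔸) - 1‖ ≤ d * ((N : ℝ) - 1) ^ 2 * δ + θ) ∧
      (∀ x, g' x ∈ U1 𝔸) ∧ U = gaugeU g' V :=
  ⟨gaugeU (axialGaugeT P U) U, (axialGaugeT P U)⁻¹, gaugeU_mem_U1 P hU (axialGaugeT_mem_U1 P hU),
    norm_gaugeU_axialGaugeT_sub_one_le P hU hδ hN hδ0 hθ0 hθ, fun x => (U1 𝔸).inv_mem (axialGaugeT_mem_U1 P hU x), (gaugeU_inv_gaugeU _ _).symm⟩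

include hU hN hδ0 hδ hθ0 hθ in
/-- **THE SAME FOR UNITARY LETTERS**: if moreover `U(b)* = U(b)⁻¹` then `V` and `g′` are unitary (`star_gaugeU`, `star_axialGaugeT`, `star_inv_gauge`) —
exactly the binders {`V(b) ∈ U1`, `V(b)* = V(b)⁻¹`, `‖V(b) − 1‖ ≤ ε`; `g′(x) ∈ U1`, `g′(x)* = g′(x)⁻¹`} of the chain's `…GaugeOrbit…_unitary` leaves.
[cite: Balaban1987RG1, (1.11)–(1.12) p.262; Balaban1985BackgroundPropagators, (3.5) p.391, (3.28) p.395] -/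
theorem exists_small_bond_gauge_unitary [StarMul 𝔸] (hUstar : ∀ b, star (U b : 𝔸) = (((U b)⁻¹ : 𝔸ˣ) : 𝔸)) :
    ∃ (V : Bond d P → 𝔸ˣ) (g' : TSite d P → 𝔸ˣ), (∀ b, V b ∈ U1 𝔸) ∧ (∀ b, star (V b : 𝔸) = (((V b)⁻¹ : 𝔸ˣ) : 𝔸)) ∧
      (∀ b, ‖(V b : 𝔸) - 1‖ ≤ d * ((N : ℝ) - 1) ^ 2 * δ + θ) ∧
      (∀ x, g' x ∈ U1 𝔸) ∧ (∀ x, star (g' x : 𝔸) = (((g' x)⁻¹ : 𝔸ˣ) : 𝔸)) ∧ U = gaugeU g' V :=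
  ⟨gaugeU (axialGaugeT P U) U, (axialGaugeT P U)⁻¹, gaugeU_mem_U1 P hU (axialGaugeT_mem_U1 P hU),
    star_gaugeU P hUstar (star_axialGaugeT P hUstar), norm_gaugeU_axialGaugeT_sub_one_le P hU hδ hN hδ0 hθ0 hθ,
    fun x => (U1 𝔸).inv_mem (axialGaugeT_mem_U1 P hU x), star_inv_gauge P (star_axialGaugeT P hUstar), (gaugeU_inv_gaugeU _ _).symm⟩

end Packaging

/-! ## §4 The no-go: on a torus the closed-line hypothesis cannot be dropped -/

section NoGo

variable [∀ i, NeZero (P i)] {𝔸 : Type*} [NormedRing 𝔸] [NormOneClass 𝔸] (h : 𝔸ˣ) (μ₀ : Fin d)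

omit [∀ i, NeZero (P i)] [NormOneClass 𝔸] in
/-- **THE SLICE FIELD HAS ALL PLAQUETTE VARIABLES EQUAL TO `1`**: `U_h(x, μ) = h` if `μ = μ₀` and `x_{μ₀} = P_{μ₀} − 1`, `= 1` otherwise; every plaquette
`p_{κν}(x)` meets the slice in zero or two `μ₀`-bonds with the same base `μ₀`-coordinate, which cancel. [cite: Balaban1985Averaging, (44)–(45) p.24] -/
theorem plaqHolU_slice_eq_one (p : B9SectCLatticeCarrier.Plaq d P) :
    plaqHolU (fun b : Bond d P => if b.2 = μ₀ ∧ (b.1 μ₀ : ℕ) + 1 = P μ₀ then h else 1) p = 1 := by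
  obtain ⟨x, ⟨⟨κ, ν⟩, hκν⟩⟩ := p
  have hne : κ ≠ ν := ne_of_lt hκν
  simp only [plaqHolU]
  by_cases hκ : κ = μ₀
  · subst hκ
    have hν : ¬ (ν = κ) := fun h' => hne h'.symm
    simp only [hν, false_and, if_false, true_and, shift_apply_ne hne, mul_one, inv_one]
    split_ifs <;> simp
  · by_cases hν : ν = μ₀
    · subst hν
      simp only [hκ, false_and, if_false, true_and, shift_apply_ne (Ne.symm hne), one_mul, inv_one, mul_one]
      split_ifs <;> simp
    · simp [hκ, hν]

omit [NormOneClass 𝔸] in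
/-- The straight `μ₀`-line of the slice field from a representative `x̃`: after `n ≤ P_{μ₀}` steps the holonomy is `h` if the slice bond (`μ₀`-coordinate
`P_{μ₀} − 1`, met at step `P_{μ₀} − 1 − x_{μ₀}`) has been crossed, `1` before. [cite: Balaban1985Averaging, (9) p.18] -/
theorem hol_slice_seg (x : TSite d P) :
    ∀ n : ℕ, n ≤ P μ₀ → hol (perCfg P fun b : Bond d P => if b.2 = μ₀ ∧ (b.1 μ₀ : ℕ) + 1 = P μ₀ then h else 1) (liftSite x) (seg μ₀ n) =
      if P μ₀ - 1 - (x μ₀ : ℕ) < n then h else 1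
  | 0, _ => by simp
  | n + 1, hn => by
    have hx := (x μ₀).isLt
    rw [show ((n + 1 : ℕ) : ℤ) = (n : ℤ) + 1 by push_cast; ring, hol_seg_natCast_succ, hol_slice_seg x n (by omega), perCfg_apply]
    have hcoord : ((perSite P (liftSite x + (n : ℤ) • e μ₀) μ₀ : ℕ)) = ((x μ₀ : ℕ) + n) % P μ₀ := by
      have h1 : (liftSite x + (n : ℤ) • e μ₀) μ₀ = (((x μ₀ : ℕ) + n : ℕ) : ℤ) := by simp [liftSite, e_apply]
      simp only [perSite, h1, ← Int.natCast_mod, Int.toNat_natCast]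
    have hcond : (((x μ₀ : ℕ) + n) % P μ₀ + 1 = P μ₀) ↔ ((x μ₀ : ℕ) + n + 1 = P μ₀) := by
      rcases Nat.lt_or_ge ((x μ₀ : ℕ) + n) (P μ₀) with hlt | hge
      · rw [Nat.mod_eq_of_lt hlt]
      · rw [Nat.mod_eq_sub_mod hge, Nat.mod_eq_of_lt (by omega)]; omega
    simp only [hcoord, true_and]
    by_cases hlt : P μ₀ - 1 - (x μ₀ : ℕ) < n
    · rw [if_pos hlt, if_neg (fun h' => by rw [hcond] at h'; omega), if_pos (by omega), mul_one]
    · rw [if_neg hlt, one_mul]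
      by_cases heq : (x μ₀ : ℕ) + n + 1 = P μ₀
      · rw [if_pos (hcond.mpr heq), if_pos (by omega)]
      · rw [if_neg (fun h' => heq (hcond.mp h')), if_neg (by omega)]

omit [NormOneClass 𝔸] in
/-- **THE CLOSED `μ₀`-LINES OF THE SLICE FIELD ARE `h`** (from every base point). [cite: Balaban1985Averaging, (9) p.18] -/
theorem lineHolT_slice (x : TSite d P) : lineHolT P (fun b : Bond d P => if b.2 = μ₀ ∧ (b.1 μ₀ : ℕ) + 1 = P μ₀ then h else 1) x μ₀ = h := by
  have hx := (x μ₀).isLt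
  rw [lineHolT_apply, hol_slice_seg P h μ₀ x (P μ₀) le_rfl, if_pos (by omega)]

/-- **NO-GO — ON A TORUS «SMALL PLAQUETTES ⇒ A SMALL-BOND GAUGE» FAILS WITHOUT THE CLOSED LINES**: the slice field `U_h` (`h ∈ U1`) has every plaquette
variable EQUAL to `1`, yet if `P_{μ₀}·ε < ‖h − 1‖` there is NO `U1`-valued gauge `g` with all `‖(U_h)^g(b) − 1‖ ≤ ε`: the closed `μ₀`-line deviation
`‖h − 1‖` is gauge invariant (§2) and at most `P_{μ₀}·ε` on the small-bond ball. [cite: Balaban1985Averaging, (45) p.24; Balaban1987RG1, (1.10)–(1.12) p.262] -/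
theorem not_small_bond_orbit_slice (hh : h ∈ U1 𝔸) {ε : ℝ} (hε : (P μ₀ : ℝ) * ε < ‖(h : 𝔸) - 1‖) (x : TSite d P) :
    ¬ ∃ g : TSite d P → 𝔸ˣ, (∀ y, g y ∈ U1 𝔸) ∧
      ∀ b, ‖((gaugeU g (fun b : Bond d P => if b.2 = μ₀ ∧ (b.1 μ₀ : ℕ) + 1 = P μ₀ then h else 1) b : 𝔸ˣ) : 𝔸) - 1‖ ≤ ε := by
  rintro ⟨g, hg, hsmall⟩
  set Uh : Bond d P → 𝔸ˣ := fun b => if b.2 = μ₀ ∧ (b.1 μ₀ : ℕ) + 1 = P μ₀ then h else 1 with hUh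
  have hUh1 : ∀ b, Uh b ∈ U1 𝔸 := fun b => by
    simp only [hUh]; split_ifs; exacts [hh, (U1 𝔸).one_mem]
  have hline := norm_lineHolT_sub_one_le_of_small_bonds P (gaugeU_mem_U1 P hUh1 hg) hsmall x μ₀
  rw [norm_lineHolT_gaugeU_sub_one P hg, lineHolT_slice] at hline
  exact absurd (hline.trans_lt hε) (lt_irrefl _)

end NoGo

end Literature.MathematicalPhysics.QuantumFieldTheory.Balaban1983to89.B7Eq45TorusGaugeOrbit

end
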